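import Literature.NumberTheory.GelbartRogawski1991.DoubledWeilRepresentationCMExplicit
import Literature.NumberTheory.GelbartRogawski1991.LocalUnitarySplittingsCM
import Literature.NumberTheory.GelbartRogawski1991.FiniteAdelicUndoubling
import HarnessLib

/-!
# The local undoublings of the explicit CM package are the CM local splittings `localSplittingCM`

[GelbartRogawski1991, §3.1 Prop. 3.1.1 p. 455 L1–3] by doubling, CM specialisation.  The tree holds the local
splittings of the CM unitary group `U(J)(L⁺_v)`, `J = T ⊗ 1`, `T = gramR` (a Gram matrix `reindex e e (diag dV ⊗ diag dW)`
of a dual pair), at every finite place in TWO spellings: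

* `GRConstruction.localSplittingAt … (cmFinLocalFamily χ hχ 𝔪₀) v` (`DoubledWeilRepresentationCMExplicit`): the local
  splitting of the EXPLICIT per-place package of the DOUBLED group `U(J ⊕ −J)` at the CM datum, at the Haar data of
  record `𝔪₀ = borelPlaceMeasure` — the finite half of the doubled Weil representation `cmDoubledWeilRep` is their
  restricted tensor product (`finHalf`, `finSplittings`);
* `LocalSplitting.localSplittingCM L n hT hTd hJ χ hχ v` (`LocalUnitarySplittingsCM`): the UNDOUBLED local splitting
  `undoubleLoc` (restrict to `U(J) × 1`, strip `⊠ 1_{𝒪}`) of Kudla's splitting `localSplittingDatumCM … v addHaar` of the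
  doubled group, assembled over the finite places as the `FinLocalSplittings` record `finLocalSplittingsCM`.

This leaf records that they are ONE object: **undoubling the explicit package's local splitting at `v` gives
`localSplittingCM … v` on the nose** (§1 `undoubleLoc_localSplittingAt_cmFinLocalFamily`, and the same in the
`FinLocalSplittings.s`/`proj_s` spelling of `finSplittings`, `undoubleLoc_finSplittings_s_cmFinLocalFamily`), hence **any
family of local splittings built from those undoublings IS the record `finLocalSplittingsCM`** (§2
`eq_finLocalSplittingsCM_of_s_eq_undoubleLoc`, through §0 `eq_finLocalSplittingsCM_of_s_eq`: a `FinLocalSplittings` record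
is determined by its field `s`, the other fields being propositions) — in particular the doubled family undone place by
place, `(finSplittings (cmFinLocalFamily …)).undouble` (`FinLocalSplittings.undouble` of `FiniteAdelicUndoubling`), IS
`finLocalSplittingsCM` (`undouble_finSplittings_cmFinLocalFamily`).  Both sides of §1 are `undoubleLoc` of the same
doubled splitting (`localSplittingAt_cmFinLocalFamily_borel'` is `rfl`), so the proofs are definitional unfoldings; the
point of the file is that consumers (the undoubling/place-assembly square of the doubled Weil representation and its CM
instance) rewrite BY NAME instead of re-running that unfolding inside larger statements.

Topic `NumberTheory/GelbartRogawski1991`; namespaces `Literature.NumberTheory.GelbartRogawski1991.UnitaryDualPair.LocalSplitting`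
(§0, that of `LocalUnitarySplittingsCM`) and `Literature.NumberTheory.GelbartRogawski1991.GRConstruction` (§1–§2, that of
`DoubledWeilRepresentationCMExplicit`).  KERNEL MATHEMATICS ONLY: theorems; no definition, no named fact, no `sorry`;
nothing of the imported modules is restated or changed.

## References
* [GelbartRogawski1991] S. Gelbart, J. Rogawski, *L-functions and Fourier–Jacobi coefficients for the unitary group
  U(3)*, Invent. Math. 105 (1991), §3.1 Prop. 3.1.1 p. 455 L1–3.
* [Kudla1994] S. Kudla, *Splitting metaplectic covers of dual reductive pairs*, Israel J. Math. 87 (1994), §3 Thm. 3.1.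

## Provenance

LEAN-IN-TREE rule, pub-hodgecm stage-1 cell, seat GR-2 ≡ own-hyp34 (gen 51); the junction of GR-2's explicit package
(`DoubledWeilRepresentationCMExplicit`) with GR-1's local-undoubling chain (`LocalUnitarySplittingsCM`).
-/

set_option autoImplicit false

noncomputable section

open scoped Classical
open scoped Matrix Kronecker TensorProduct
open NumberField IsDedekindDomain
open Literature.RepresentationTheory.HeisenbergGroup
open Literature.NumberTheory.Automorphic
open Literature.NumberTheory.Weil1964
open Literature.RepresentationTheory.HarrisKudlaSweet1996
open Literature.NumberTheory.GaloisRepresentations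

namespace Literature.NumberTheory.GelbartRogawski1991.UnitaryDualPair.LocalSplitting

/-! ## §0 A `FinLocalSplittings` record is determined by its local splittings -/

variable (L : Type) [Field L] [NumberField L] [IsCMField L] (n : ℕ) {T₀ : Matrix (Fin n) (Fin n) (maximalRealSubfield L)}
  (hT₀ : T₀.IsSymm) (hT₀d : IsUnit T₀.det) {J : Matrix (Fin n) (Fin n) L}
  (hJ : J = T₀.map (algebraMap (maximalRealSubfield L) L)) (χ : HeckeCharacter L) (hχ : IsSplittingChar L 1 χ)

/-- **a family of local splittings of `U(J)(L⁺_v)` whose members are the CM local splittings `localSplittingCM … v` IS the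
record `finLocalSplittingsCM`** — the remaining fields of `FinLocalSplittings` (over `ι_v`, smooth, unramified almost
everywhere) are propositions.  (For any symmetric `T₀ ∈ GL_n(L⁺)`; the use below is `T₀ := gramR`.)
[cite: GelbartRogawski1991, §3.1 Prop. 3.1.1 p. 455 L1–3] -/
theorem eq_finLocalSplittingsCM_of_s_eq
    (𝓢 : FinLocalSplittings (maximalRealSubfield L) L (IsCMField.complexConj L) n (complexConj_imagUnit L)
      (imagUnit_ne_zero L) (imagUnit_mul_self L) T₀ hT₀ hJ)
    (hs : ∀ v, 𝓢.s v = localSplittingCM L n hT₀ hT₀d hJ χ hχ v) :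
    𝓢 = finLocalSplittingsCM L n hT₀ hT₀d hJ χ hχ := by
  obtain ⟨s, hps, hsm, hur⟩ := 𝓢
  obtain rfl : s = localSplittingCM L n hT₀ hT₀d hJ χ hχ := funext hs
  rfl

end Literature.NumberTheory.GelbartRogawski1991.UnitaryDualPair.LocalSplitting

namespace Literature.NumberTheory.GelbartRogawski1991.GRConstruction

open UnitaryDualPair

variable (L : Type) [Field L] [NumberField L] [IsCMField L]

variable {N M n : ℕ} (e : Fin N × Fin M ≃ Fin n)
  (dV : Fin N → L) (hdV : ∀ i, IsCMField.complexConj L (dV i) = dV i) (hdV0 : ∀ i, dV i ≠ 0)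
  (dW : Fin M → L) (hdW : ∀ i, IsCMField.complexConj L (dW i) = dW i) (hdW0 : ∀ i, dW i ≠ 0)

open Literature.NumberTheory.GelbartRogawski1991.UnitaryDualPair.LocalSplitting hiding IsSiegelDelta chiDet deltaBlock
  detDelta e₂ gramD gramD_isSymm gramS hermD isUnit_det_gramD
open MeasureTheory

variable (χ : HeckeCharacter L) (hχ : IsSplittingChar L 1 χ)
  {J : Matrix (Fin n) (Fin n) L} (hJ : J = (gramR L e dV hdV dW hdW).map (algebraMap (Fp L) L))
  (hJD : hermD L e dV hdV dW hdW =
    (Literature.NumberTheory.GelbartRogawski1991.UnitaryDualPair.LocalSplitting.gramD (Fp L) n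
      (gramR L e dV hdV dW hdW)).map (algebraMap (Fp L) L))

/-! ## §1 At one finite place -/

/-- **undoubling the explicit CM package's local splitting at `v` gives the CM local splitting `localSplittingCM … v`**
(Haar data of record on both sides: Borel σ-algebra, `Measure.addHaar`), for every spelling `hJD` of `J^𝔻 = T^𝔻 ⊗ 1` and
every witness `hproj` that the doubled splitting lies over `ι^𝔻_v` — a definitional unfolding
(`localSplittingAt_cmFinLocalFamily_borel'`, `localSplittingCM`, `localSplittingCMWith`).
[cite: GelbartRogawski1991, §3.1 Prop. 3.1.1 p. 455 L1–3] [cite: Kudla1994, §3 Thm. 3.1] -/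
theorem undoubleLoc_localSplittingAt_cmFinLocalFamily (v : HeightOneSpectrum (𝓞 (Fp L)))
    (hproj : ∀ g, MpPsi.proj _
        (localSplittingAt L e dV hdV hdV0 dW hdW hdW0 χ (borelPlaceMeasure L)
          (cmFinLocalFamily L e dV hdV hdV0 dW hdW hdW0 χ hχ (borelPlaceMeasure L)) v g) =
      iota (Fp L) L (IsCMField.complexConj L) (n + n) (complexConj_imagUnit L) (imagUnit_ne_zero L) (imagUnit_mul_self L)
        (Literature.NumberTheory.GelbartRogawski1991.UnitaryDualPair.LocalSplitting.gramD (Fp L) n (gramR L e dV hdV dW hdW))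
        (Literature.NumberTheory.GelbartRogawski1991.UnitaryDualPair.LocalSplitting.gramD_isSymm (Fp L) n
          (gramR_isSymm L e dV hdV dW hdW)) hJD v g) :
    undoubleLoc (Fp L) L (IsCMField.complexConj L) v n hJ hJD (complexConj_imagUnit L) (imagUnit_ne_zero L)
        (imagUnit_mul_self L) (gramR_isSymm L e dV hdV dW hdW) (isUnit_det_gramR₀ L e dV hdV hdV0 dW hdW hdW0)
        (localSplittingAt L e dV hdV hdV0 dW hdW hdW0 χ (borelPlaceMeasure L)
          (cmFinLocalFamily L e dV hdV hdV0 dW hdW hdW0 χ hχ (borelPlaceMeasure L)) v) hproj =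
      localSplittingCM L n (gramR_isSymm L e dV hdV dW hdW) (isUnit_det_gramR₀ L e dV hdV hdV0 dW hdW hdW0) hJ χ hχ v :=
  rfl

/-- the same in the `FinLocalSplittings` spelling of the package's family `finSplittings … (cmFinLocalFamily …)` (fields
`s v`, `proj_s v`, and the `J^𝔻 = T^𝔻 ⊗ 1` witness carried by the type of `finSplittings`, left implicit) — the shape
`undoubleLoc (s v) (proj_s v)` in which a place-by-place undoubling of that family is written (`FinLocalSplittings.undouble_s`).
Consume it by term application ∕ `exact`, or through `eq_finLocalSplittingsCM_of_s_eq_undoubleLoc` below: the implicit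
`T`-slot and the `J^𝔻`-witness of a consumer's term agree with these up to unfolding `gramR` ∕ `hermD` (default
transparency), which `rw`'s reducible matching does not perform.
[cite: GelbartRogawski1991, §3.1 Prop. 3.1.1 p. 455 L1–3] [cite: Kudla1994, §3 Thm. 3.1] -/
theorem undoubleLoc_finSplittings_s_cmFinLocalFamily (v : HeightOneSpectrum (𝓞 (Fp L))) :
    undoubleLoc (Fp L) L (IsCMField.complexConj L) v n hJ _ (complexConj_imagUnit L) (imagUnit_ne_zero L)
        (imagUnit_mul_self L) (gramR_isSymm L e dV hdV dW hdW) (isUnit_det_gramR₀ L e dV hdV hdV0 dW hdW hdW0)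
        ((finSplittings L e dV hdV hdV0 dW hdW hdW0 χ (borelPlaceMeasure L)
          (cmFinLocalFamily L e dV hdV hdV0 dW hdW hdW0 χ hχ (borelPlaceMeasure L))).s v)
        ((finSplittings L e dV hdV hdV0 dW hdW hdW0 χ (borelPlaceMeasure L)
          (cmFinLocalFamily L e dV hdV hdV0 dW hdW hdW0 χ hχ (borelPlaceMeasure L))).proj_s v) =
      localSplittingCM L n (gramR_isSymm L e dV hdV dW hdW) (isUnit_det_gramR₀ L e dV hdV hdV0 dW hdW hdW0) hJ χ hχ v :=
  rfl

/-- pointwise form: `undoubleLoc (s^𝔻_v) g = localSplittingCM … v g` for every `g ∈ U(J)(L⁺_v)`.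
[cite: GelbartRogawski1991, §3.1 Prop. 3.1.1 p. 455 L1–3] -/
theorem undoubleLoc_finSplittings_s_cmFinLocalFamily_apply (v : HeightOneSpectrum (𝓞 (Fp L)))
    (g : UnitaryGroup.localPi L (IsCMField.complexConj L) n J v) :
    undoubleLoc (Fp L) L (IsCMField.complexConj L) v n hJ _ (complexConj_imagUnit L) (imagUnit_ne_zero L)
        (imagUnit_mul_self L) (gramR_isSymm L e dV hdV dW hdW) (isUnit_det_gramR₀ L e dV hdV hdV0 dW hdW hdW0)
        ((finSplittings L e dV hdV hdV0 dW hdW hdW0 χ (borelPlaceMeasure L)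
          (cmFinLocalFamily L e dV hdV hdV0 dW hdW hdW0 χ hχ (borelPlaceMeasure L))).s v)
        ((finSplittings L e dV hdV hdV0 dW hdW hdW0 χ (borelPlaceMeasure L)
          (cmFinLocalFamily L e dV hdV hdV0 dW hdW hdW0 χ hχ (borelPlaceMeasure L))).proj_s v) g =
      localSplittingCM L n (gramR_isSymm L e dV hdV dW hdW) (isUnit_det_gramR₀ L e dV hdV hdV0 dW hdW hdW0) hJ χ hχ v g :=
  rfl

/-! ## §2 As a family over the finite places -/

/-- **THE UNDOUBLED EXPLICIT CM PACKAGE IS GR's CM RECORD `finLocalSplittingsCM`** (at `T := gramR`, same `χ`, Haar data of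
record): every family `𝓢` of local splittings of `U(J)` whose members are the place-by-place undoublings
`undoubleLoc (s^𝔻_v)` of the package's family `finSplittings … (cmFinLocalFamily χ hχ borelPlaceMeasure)` — hypothesis `hs`,
which is `fun _ => rfl` for a family built field-wise from those undoublings — equals `finLocalSplittingsCM L n … hJ χ hχ`.
So the undoubling/place-assembly square of the doubled Weil representation, read at the explicit CM package, lands in the
`FinLocalSplittings` consumed downstream with no transport.
[cite: GelbartRogawski1991, §3.1 Prop. 3.1.1 p. 455 L1–3] [cite: Kudla1994, §3 Thm. 3.1] -/
theorem eq_finLocalSplittingsCM_of_s_eq_undoubleLoc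
    (𝓢 : FinLocalSplittings (Fp L) L (IsCMField.complexConj L) n (complexConj_imagUnit L) (imagUnit_ne_zero L)
      (imagUnit_mul_self L) (gramR L e dV hdV dW hdW) (gramR_isSymm L e dV hdV dW hdW) hJ)
    (hs : ∀ v, 𝓢.s v =
      undoubleLoc (Fp L) L (IsCMField.complexConj L) v n hJ _ (complexConj_imagUnit L) (imagUnit_ne_zero L)
        (imagUnit_mul_self L) (gramR_isSymm L e dV hdV dW hdW) (isUnit_det_gramR₀ L e dV hdV hdV0 dW hdW hdW0)
        ((finSplittings L e dV hdV hdV0 dW hdW hdW0 χ (borelPlaceMeasure L)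
          (cmFinLocalFamily L e dV hdV hdV0 dW hdW hdW0 χ hχ (borelPlaceMeasure L))).s v)
        ((finSplittings L e dV hdV hdV0 dW hdW hdW0 χ (borelPlaceMeasure L)
          (cmFinLocalFamily L e dV hdV hdV0 dW hdW hdW0 χ hχ (borelPlaceMeasure L))).proj_s v)) :
    𝓢 = finLocalSplittingsCM L n (gramR_isSymm L e dV hdV dW hdW) (isUnit_det_gramR₀ L e dV hdV hdV0 dW hdW hdW0) hJ χ hχ :=
  eq_finLocalSplittingsCM_of_s_eq L n (gramR_isSymm L e dV hdV dW hdW) (isUnit_det_gramR₀ L e dV hdV hdV0 dW hdW hdW0)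
    hJ χ hχ 𝓢 fun v => (hs v).trans (undoubleLoc_finSplittings_s_cmFinLocalFamily L e dV hdV hdV0 dW hdW hdW0 χ hχ hJ v)

/-- **`(finSplittings (cmFinLocalFamily χ hχ 𝔪₀)).undouble = finLocalSplittingsCM … χ hχ`**: the doubled family of the
explicit CM package undone place by place (`FinLocalSplittings.undouble` of `FiniteAdelicUndoubling`) IS GR's CM record of
local splittings of `U(J)` at `T := gramR` (Haar data of record on both sides).  The instance of
`eq_finLocalSplittingsCM_of_s_eq_undoubleLoc` at `hs := fun _ => rfl` (`FinLocalSplittings.undouble_s`).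
[cite: GelbartRogawski1991, §3.1 Prop. 3.1.1 p. 455 L1–3] [cite: Kudla1994, §3 Thm. 3.1] -/
theorem undouble_finSplittings_cmFinLocalFamily :
    (finSplittings L e dV hdV hdV0 dW hdW hdW0 χ (borelPlaceMeasure L)
        (cmFinLocalFamily L e dV hdV hdV0 dW hdW hdW0 χ hχ (borelPlaceMeasure L))).undouble hJ
      (gramR_isSymm L e dV hdV dW hdW) (isUnit_det_gramR₀ L e dV hdV hdV0 dW hdW hdW0) =
    finLocalSplittingsCM L n (gramR_isSymm L e dV hdV dW hdW) (isUnit_det_gramR₀ L e dV hdV hdV0 dW hdW hdW0) hJ χ hχ :=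
  eq_finLocalSplittingsCM_of_s_eq_undoubleLoc L e dV hdV hdV0 dW hdW hdW0 χ hχ hJ _ fun _ => rfl

/-- the same at one place: `(finSplittings (cmFinLocalFamily …)).undouble.s v = localSplittingCM … v`.
[cite: GelbartRogawski1991, §3.1 Prop. 3.1.1 p. 455 L1–3] -/
theorem undouble_finSplittings_cmFinLocalFamily_s (v : HeightOneSpectrum (𝓞 (Fp L))) :
    ((finSplittings L e dV hdV hdV0 dW hdW hdW0 χ (borelPlaceMeasure L)
        (cmFinLocalFamily L e dV hdV hdV0 dW hdW hdW0 χ hχ (borelPlaceMeasure L))).undouble hJ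
      (gramR_isSymm L e dV hdV dW hdW) (isUnit_det_gramR₀ L e dV hdV hdV0 dW hdW hdW0)).s v =
    localSplittingCM L n (gramR_isSymm L e dV hdV dW hdW) (isUnit_det_gramR₀ L e dV hdV hdV0 dW hdW hdW0) hJ χ hχ v :=
  undoubleLoc_finSplittings_s_cmFinLocalFamily L e dV hdV hdV0 dW hdW hdW0 χ hχ hJ v

end Literature.NumberTheory.GelbartRogawski1991.GRConstruction

end
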